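import Mathlib

/-!
# Uniqueness of the recessive solution of a Riccati equation

If `W₁` and `W₂` both solve `W′ = U − W²` on a half-line `(a, ∞)` and are both *recessive* with the
same index, `x·W₁(x) → −c` and `x·W₂(x) → −c` with `c > 0`, then `W₁ = W₂` on `(a, ∞)`
(`riccati_recessive_unique`).  Indeed `Δ = W₁ − W₂` solves the LINEAR equation `Δ′ = −(W₁ + W₂)Δ`
whose coefficient is eventually `≥ c/x > 0`, so `Δ²·x^{−c}` is eventually non-decreasing while
`Δ → 0`: hence `Δ` vanishes far out, and then everywhere by backward uniqueness for the linear
equation (a weighted-monotonicity argument, no Lipschitz/Gronwall machinery).  This identifies any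
ladder `(W_k)` satisfying the recessive normalisation `x W_k → −(ℓ − k)` of the photon-sphere route's
stub R with the explicitly constructed recessive chain. [folklore]
-/

noncomputable section

namespace Literature.Analysis.ODE

open Set Filter Topology

/-- Backward vanishing for `φ′ = q φ`-type inequalities: if `φ ≥ 0` on `[x, X]`, `φ(X) = 0`, and
`φ′ ≥ −K φ` there, then `φ(x) = 0`. [folklore] -/
theorem eq_zero_of_deriv_ge_neg_mul {φ φ' : ℝ → ℝ} {x X K : ℝ} (hxX : x ≤ X)
    (hφ : ∀ t ∈ Icc x X, HasDerivAt φ (φ' t) t) (hpos : ∀ t ∈ Icc x X, 0 ≤ φ t)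
    (hineq : ∀ t ∈ Icc x X, -K * φ t ≤ φ' t) (hX : φ X = 0) : φ x = 0 := by
  -- h(t) = φ(t) e^{K t} is non-decreasing on [x, X]
  have hexp : ∀ t, HasDerivAt (fun t => Real.exp (K * t)) (Real.exp (K * t) * K) t := by
    intro t
    simpa using ((hasDerivAt_id t).const_mul K).exp
  have hmono : MonotoneOn (fun t => φ t * Real.exp (K * t)) (Icc x X) := by
    apply monotoneOn_of_deriv_nonneg (convex_Icc x X)
    · intro t ht
      exact ((hφ t ht).continuousAt.mul (hexp t).continuousAt).continuousWithinAt
    · intro t ht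
      have ht' : t ∈ Icc x X := interior_subset ht
      exact ((hφ t ht').fun_mul (hexp t)).differentiableAt.differentiableWithinAt
    · intro t ht
      have ht' : t ∈ Icc x X := interior_subset ht
      have hd := (hφ t ht').fun_mul (hexp t)
      rw [hd.deriv]
      have he := Real.exp_pos (K * t)
      have := hineq t ht'
      have h2 : 0 ≤ (φ' t + K * φ t) * Real.exp (K * t) := mul_nonneg (by linarith) he.le
      have e : φ' t * Real.exp (K * t) + φ t * (Real.exp (K * t) * K) =
          (φ' t + K * φ t) * Real.exp (K * t) := by ring
      rw [e]; exact h2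
  have h := hmono (left_mem_Icc.2 hxX) (right_mem_Icc.2 hxX) hxX
  simp only [hX, zero_mul] at h
  have he := Real.exp_pos (K * x)
  have hφx := hpos x (left_mem_Icc.2 hxX)
  nlinarith

/-- **Uniqueness of the recessive Riccati solution.**  Two solutions of `W′ = U − W²` on `(a, ∞)`
with `x W₁ → −c`, `x W₂ → −c`, `c > 0`, coincide on `(a, ∞)`. [folklore] -/
theorem riccati_recessive_unique {W₁ W₂ U : ℝ → ℝ} {a c : ℝ} (hc : 0 < c)
    (h₁ : ∀ x, a < x → HasDerivAt W₁ (U x - W₁ x ^ 2) x)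
    (h₂ : ∀ x, a < x → HasDerivAt W₂ (U x - W₂ x ^ 2) x)
    (hl₁ : Tendsto (fun x => x * W₁ x) atTop (𝓝 (-c)))
    (hl₂ : Tendsto (fun x => x * W₂ x) atTop (𝓝 (-c))) :
    ∀ x, a < x → W₁ x = W₂ x := by
  -- Δ = W₁ − W₂ solves Δ′ = p Δ with p = −(W₁ + W₂); φ = Δ² solves φ′ = 2 p φ
  set Δ : ℝ → ℝ := fun x => W₁ x - W₂ x with hΔ
  set p : ℝ → ℝ := fun x => -(W₁ x + W₂ x) with hp
  have hΔd : ∀ x, a < x → HasDerivAt Δ (p x * Δ x) x := by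
    intro x hx
    have h := (h₁ x hx).sub (h₂ x hx)
    refine h.congr_deriv ?_
    simp only [hp, hΔ]
    ring
  set φ : ℝ → ℝ := fun x => Δ x ^ 2 with hφ
  have hφd : ∀ x, a < x → HasDerivAt φ (2 * p x * φ x) x := by
    intro x hx
    have h := (hΔd x hx).fun_pow 2
    refine h.congr_deriv ?_
    simp only [hφ, Nat.cast_ofNat]
    ring
  -- far out: x p(x) ≥ c (from x(W₁+W₂) → −2c) and x Δ → 0
  have hsum : Tendsto (fun x => x * (W₁ x + W₂ x)) atTop (𝓝 (-c + -c)) := by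
    have := hl₁.add hl₂
    refine this.congr' ?_
    filter_upwards with x
    ring
  have hev₁ : ∀ᶠ x in atTop, c ≤ x * p x := by
    have : ∀ᶠ x in atTop, x * (W₁ x + W₂ x) < -c := by
      apply hsum.eventually (gt_mem_nhds _)
      linarith
    filter_upwards [this] with x hx
    simp only [hp]
    nlinarith
  have hdiff : Tendsto (fun x => x * Δ x) atTop (𝓝 0) := by
    have := hl₁.sub hl₂
    simp only [sub_self] at this
    refine this.congr' ?_
    filter_upwards with x
    simp only [hΔ]; ring
  -- Step 1: φ = 0 beyond some X₀
  obtain ⟨X₀, hX₀⟩ : ∃ X₀, ∀ x, X₀ ≤ x → a < x ∧ 1 ≤ x ∧ c ≤ x * p x := by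
    have h := (hev₁.and ((eventually_gt_atTop a).and (eventually_ge_atTop (1:ℝ))))
    obtain ⟨X₀, hX₀⟩ := h.exists_forall_of_atTop
    exact ⟨X₀, fun x hx => ⟨(hX₀ x hx).2.1, (hX₀ x hx).2.2, (hX₀ x hx).1⟩⟩
  have hfar : ∀ x, X₀ ≤ x → φ x = 0 := by
    intro x₁ hx₁
    by_contra hne
    have hφpos : 0 < φ x₁ := lt_of_le_of_ne (sq_nonneg _) (Ne.symm hne)
    obtain ⟨hax₁, h1x₁, -⟩ := hX₀ x₁ hx₁
    have hx₁pos : 0 < x₁ := by linarith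
    -- ψ(x) = φ(x) · x^{−c} is non-decreasing on [x₁, ∞): ψ′ = x^{−c−1} φ (2 x p − c) ≥ 0
    have hmono : ∀ b, x₁ ≤ b → φ x₁ * x₁ ^ (-c) ≤ φ b * b ^ (-c) := by
      intro b hb
      have hmon : MonotoneOn (fun x => φ x * x ^ (-c)) (Icc x₁ b) := by
        apply monotoneOn_of_deriv_nonneg (convex_Icc x₁ b)
        · intro t ht
          have htpos : 0 < t := lt_of_lt_of_le hx₁pos ht.1
          exact ((hφd t (lt_of_lt_of_le hax₁ ht.1)).continuousAt.mul
            (continuousAt_id.rpow_const (Or.inl htpos.ne'))).continuousWithinAt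
        · intro t ht
          have ht' := interior_subset ht
          have htpos : 0 < t := lt_of_lt_of_le hx₁pos ht'.1
          exact ((hφd t (lt_of_lt_of_le hax₁ ht'.1)).fun_mul
            (Real.hasDerivAt_rpow_const (p := -c) (Or.inl htpos.ne'))).differentiableAt.differentiableWithinAt
        · intro t ht
          have ht' := interior_subset ht
          have htpos : 0 < t := lt_of_lt_of_le hx₁pos ht'.1
          have hd := (hφd t (lt_of_lt_of_le hax₁ ht'.1)).fun_mul
            (Real.hasDerivAt_rpow_const (p := -c) (Or.inl htpos.ne'))
          rw [hd.deriv]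
          obtain ⟨-, -, hcp⟩ := hX₀ t (le_trans hx₁ ht'.1)
          have hφt : 0 ≤ φ t := sq_nonneg _
          have hr : 0 < t ^ (-c) := Real.rpow_pos_of_pos htpos _
          have hr1 : t ^ (-c - 1) = t ^ (-c) / t := by
            rw [Real.rpow_sub_one htpos.ne']
          rw [hr1]
          -- 2 p φ t^{-c} + φ (−c) t^{−c}/t = φ t^{−c} (2p − c/t) ≥ 0 since t p ≥ c
          have h2p : c / t ≤ 2 * p t := by
            rw [div_le_iff₀ htpos]; nlinarith
          have : 0 ≤ φ t * t ^ (-c) * (2 * p t - c / t) := by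
            apply mul_nonneg (mul_nonneg hφt hr.le); linarith
          have e : 2 * p t * φ t * t ^ (-c) + φ t * (-c * (t ^ (-c) / t)) =
              φ t * t ^ (-c) * (2 * p t - c / t) := by
            field_simp
            ring
          rw [e]; exact this
      exact hmon (left_mem_Icc.2 hb) (right_mem_Icc.2 hb) hb
    -- but φ b · b^{−c} ≤ φ b → 0: contradiction
    have hφlim : Tendsto φ atTop (𝓝 0) := by
      -- Δ = (x Δ)/x → 0·... : use |Δ x| ≤ |x Δ x| for x ≥ 1, then square
      have hΔlim : Tendsto Δ atTop (𝓝 0) := by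
        have hinv : Tendsto (fun x : ℝ => x⁻¹) atTop (𝓝 0) := tendsto_inv_atTop_zero
        have := hdiff.mul hinv
        simp only [zero_mul] at this
        refine this.congr' ?_
        filter_upwards [eventually_gt_atTop (0:ℝ)] with x hx
        field_simp
      simpa [hφ] using hΔlim.pow 2
    have hψlim : Tendsto (fun b => φ b * b ^ (-c)) atTop (𝓝 0) := by
      -- 0 ≤ φ b b^{-c} ≤ φ b for b ≥ 1
      refine tendsto_of_tendsto_of_tendsto_of_le_of_le' tendsto_const_nhds hφlim ?_ ?_
      · filter_upwards [eventually_gt_atTop (0:ℝ)] with b hb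
        exact mul_nonneg (sq_nonneg _) (Real.rpow_pos_of_pos hb _).le
      · filter_upwards [eventually_ge_atTop (1:ℝ)] with b hb
        have : b ^ (-c) ≤ 1 := Real.rpow_le_one_of_one_le_of_nonpos hb (by linarith)
        exact mul_le_of_le_one_right (sq_nonneg _) this
    have hlow : 0 < φ x₁ * x₁ ^ (-c) := mul_pos hφpos (Real.rpow_pos_of_pos hx₁pos _)
    have hev : ∀ᶠ b in atTop, φ b * b ^ (-c) < φ x₁ * x₁ ^ (-c) :=
      hψlim.eventually (gt_mem_nhds hlow)
    obtain ⟨b, hb, hbge⟩ := (hev.and (eventually_ge_atTop x₁)).exists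
    have := hmono b hbge
    linarith
  -- Step 2: φ = 0 on (a, X₀] by backward uniqueness on [x, X₀]
  intro x hx
  have hφx : φ x = 0 := by
    rcases le_or_gt X₀ x with hxX | hxX
    · exact hfar x hxX
    · -- bound |p| on [x, X₀] by continuity
      have hcont : ContinuousOn p (Icc x X₀) := by
        intro t ht
        have hat : a < t := lt_of_lt_of_le hx ht.1
        exact (((h₁ t hat).continuousAt.add (h₂ t hat).continuousAt).neg).continuousWithinAt
      obtain ⟨K, hK⟩ := (isCompact_Icc.image_of_continuousOn hcont).isBounded.subset_closedBall 0
      -- use K' = max K 0 via the bound |p t| ≤ K'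
      have hKb : ∀ t ∈ Icc x X₀, |p t| ≤ max K 0 := by
        intro t ht
        have : p t ∈ Metric.closedBall (0:ℝ) K := hK (mem_image_of_mem p ht)
        rw [Metric.mem_closedBall, Real.dist_eq, sub_zero] at this
        exact this.trans (le_max_left _ _)
      refine eq_zero_of_deriv_ge_neg_mul (K := 2 * max K 0) hxX.le
        (fun t ht => hφd t (lt_of_lt_of_le hx ht.1)) (fun t _ => sq_nonneg _) ?_ (hfar X₀ le_rfl)
      intro t ht
      have hb := hKb t ht
      have hφt : 0 ≤ φ t := sq_nonneg _
      have : -(max K 0) ≤ p t := (abs_le.1 hb).1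
      nlinarith
  have : Δ x = 0 := by simpa [hφ] using hφx
  simpa [hΔ, sub_eq_zero] using this

end Literature.Analysis.ODE
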